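import Summits.Langlands.Langlands.Theses.PrimitiveRankLadder

/-!
# Route PrimitiveRankLadder — Assembly

The assembly item (stmt-Langlands-24807) of route `PrimitiveRankLadder` (DRAFT):
`RankOneAutomorphy → RankTwoPrimitiveAutomorphy → HigherRankPrimitiveAutomorphy → CyclicInductionTransport → SatakeAvatarExistence → PadicMemberCompatibility → CompatibilityAwayFromLR → CanonicalReciprocityData → _root_.Langlands`.

This is literally the type of the route file's sorry-free deciding theorem
`Summit.Langlands.Langlands.Theses.PrimitiveRankLadder.closes` (same hypotheses, in the same order, same
conclusion). Nothing here proves the summit: the assembly records only that the items of the route,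
taken together, imply the route's conclusion by name (registry hygiene; count-neutral).
decomp-langlands lens-6 g42 assembly sweep; census `FernRankSplitAssembly` template.
-/

set_option linter.dupNamespace false -- `Summit.Langlands.Langlands` is the mandated namespace

namespace Summit.Langlands.Langlands.Theorems

/-- **Assembly of route PrimitiveRankLadder** (stmt-Langlands-24807): the chain of the route's items to its conclusion.
Proof: unfold `Assembly` and apply the route's deciding theorem `Theses.PrimitiveRankLadder.closes`. -/
theorem primitiveRankLadder_assembly_proof :
    Summit.Langlands.Langlands.Theses.PrimitiveRankLadder.Assembly := by
  unfold Summit.Langlands.Langlands.Theses.PrimitiveRankLadder.Assembly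
  exact Summit.Langlands.Langlands.Theses.PrimitiveRankLadder.closes

end Summit.Langlands.Langlands.Theorems
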